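import Summits.PneNP.PneNP.Theses.SzkEntropy
import Literature.Computability.Complexity.PolynomialEntropyApproximation
import Literature.Computability.Complexity.PEADegreeReduction

/-!
# PneNP / SzkEntropy — `PeaDegreeReduction` (stmt-PneNP-10780): library bridge and the trivial half `d ≤ 3`

Route `PneNP/SzkEntropy`, support item stmt-PneNP-10780 (`PeaDegreeReduction`, rank 9):

  `∀ d, PEA_d ≤ₚ PEA_3` (Karp reduction of promise problems, `PromiseProblem.PolyTimeReducible`).

For `d ≥ 4` this is the Applebaum–Ishai–Kushilevitz / Dvir–Gutfreund–Rothblum–Vadhan degree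
reduction by perfect degree-3 randomizing polynomials (`H(p̂) = H(p) + s`), a large formalisation
not attempted here.  This file records, as SUPPORT lemmas of the item,

* `szkEntropy_peaDegreeReduction_iff` — the route decl (inline `let ev/H/PEA := …` spelling) is
  DEFINITIONALLY `∀ d, (PEA d).PolyTimeReducible (PEA 3)` over the library's named problem
  `Literature.Computability.Complexity.PEA`;
* `polyTimeReducible_of_subset` — a promise problem whose yes- and no-sets are contained in those
  of another reduces to it by the identity (`PolyTimeComputable.id`);
* `PEA_polyTimeReducible_of_le` — hence `PEA_d ≤ₚ PEA_{d'}` for `d ≤ d'` (`PEA_yes_mono`,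
  `PEA_no_mono`), in particular the half `d ≤ 3` of the item
  (`szkEntropy_peaDegreeReduction_of_le_three`).

References: Z. Dvir, D. Gutfreund, G. N. Rothblum, S. Vadhan, *On approximating the entropy of
polynomial mappings*, ICS 2011 (ECCC TR10-160), §3 p. 6 and Thm 4.5 / Claim 4.4;
O. Goldreich, *On promise problems* (2006), Def. 1.4.
-/

namespace Summit.PneNP.PneNP.Theorems

open Literature.Computability.Complexity

/-- **The route's `PeaDegreeReduction` is the library statement `∀ d, PEA d ≤ₚ PEA 3`.** The
inline `let ev/H/PEA := …` spelling (route SzkEntropy, item stmt-PneNP-10780) unfolds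
definitionally to the statement over `Literature.Computability.Complexity.PEA`.
[DvirGutfreundRothblumVadhan2010, §3 p. 6 and Thm 4.5] -/
theorem szkEntropy_peaDegreeReduction_iff :
    Summit.PneNP.PneNP.Theses.SzkEntropy.PeaDegreeReduction ↔
      ∀ d : ℕ, (PEA d).PolyTimeReducible (PEA 3) :=
  Iff.rfl

/-- **Identity reductions.** If the yes-instances of `Q₁` are yes-instances of `Q₂` and the
no-instances of `Q₁` are no-instances of `Q₂`, then `Q₁` Karp-reduces to `Q₂` by the identity
map (which is in `FP`, `PolyTimeComputable.id`). [Goldreich2006, Def. 1.4] -/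
theorem polyTimeReducible_of_subset {Q₁ Q₂ : PromiseProblem}
    (hy : Q₁.yes ≤ Q₂.yes) (hn : Q₁.no ≤ Q₂.no) : Q₁.PolyTimeReducible Q₂ :=
  ⟨id, PolyTimeComputable.id id, fun _ hx => hy hx, fun _ hx => hn hx⟩

/-- **`PEA_d ≤ₚ PEA_{d'}` for `d ≤ d'`**, by the identity: a degree-`≤ d` instance is a
degree-`≤ d'` instance with the same entropy and threshold (`PEA_yes_mono`, `PEA_no_mono`).
[DvirGutfreundRothblumVadhan2010, §3 p. 6] -/
theorem PEA_polyTimeReducible_of_le {d d' : ℕ} (h : d ≤ d') :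
    (PEA d).PolyTimeReducible (PEA d') :=
  polyTimeReducible_of_subset (PEA_yes_mono h) (PEA_no_mono h)

/-- **The half `d ≤ 3` of `PeaDegreeReduction`**: `PEA_d ≤ₚ PEA_3` for every `d ≤ 3` (identity
reduction).  The half `d ≥ 4` is the AIK/DGRV degree reduction by randomizing polynomials and is
not proved here. [DvirGutfreundRothblumVadhan2010, Thm 4.5 and Claim 4.4;
ApplebaumIshaiKushilevitz2006] -/
theorem szkEntropy_peaDegreeReduction_of_le_three {d : ℕ} (hd : d ≤ 3) :
    (PEA d).PolyTimeReducible (PEA 3) :=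
  PEA_polyTimeReducible_of_le hd

/-- **`PeaDegreeReduction` holds** (item stmt-PneNP-10780 PROVED): for every `d`, `PEA_d`
Karp-reduces to `PEA_3` — by the Literature theorem `PEA_polyTimeReducible_PEA_three` (degree
reduction by perfect degree-3 randomizing polynomials: the Ishai–Kushilevitz matrix encoding of each
monomial, sum splitting with fresh masks, `H(P') = H(P) + m` for the `m` fresh variables, and a
typed polynomial-time program for the instance map; files `RandomizingPolynomials*.lean`,
`DegreeThreeEncoding*.lean`, `PEADegreeReduction.lean`) through the definitional bridge
`szkEntropy_peaDegreeReduction_iff`. [DvirGutfreundRothblumVadhan2010, Thm 4.5 and Claim 4.4;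
IshaiKushilevitz2002, §3; ApplebaumIshaiKushilevitz2006, §4] -/
theorem szkEntropy_peaDegreeReduction_proof :
    Summit.PneNP.PneNP.Theses.SzkEntropy.PeaDegreeReduction :=
  szkEntropy_peaDegreeReduction_iff.2 PEA_polyTimeReducible_PEA_three

end Summit.PneNP.PneNP.Theorems
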